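import Literature.Geometry.Kaehler.ComplexTorusAnalyticCycleIntersectionNonneg
import Literature.Geometry.Kaehler.ComplexTorusZuckerNoCurves
import HarnessLib

/-!
# Zucker's mechanism in codimension one: a complex torus whose divisor classes are anti-invariant under a
# `ℂ`-linear map carries no analytic hypersurface

S. Zucker, *The Hodge conjecture for cubic fourfolds*, Compositio Math. 34 (1977), Appendix B, proof of the
Theorem p. 208: "`J^*β = -β` for all `β ∈ H^{n,n}(T, ℤ)`. If `β` were the fundamental class of an effective
analytic cycle `Z`, then […] `Z + J⁻¹Z` would be homologous to zero […] However no effective analytic cycle can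
be homologous to zero on a compact Kähler manifold". This file isolates the mechanism for DIVISORS (`n = 1`,
classes of type `(1,1)`) on an arbitrary complex torus `X = E/Λ`, where the Kähler positivity is the
point-wise statement "the class of an analytic hypersurface is `≥ 0` on every complex line and `≠ 0`" (Lelong;
rows A2-113/A4 of lane `lit-hodgefound`, `ComplexTorusAnalyticCycleClassPositive`,
`ComplexTorusAnalyticCycleIntersectionNonneg`):

* §1 `ComplexTorus.eq_zero_of_typeOneOne_of_forall_apply_I_smul_eq_zero` — a `2`-form of type `(1,1)` with
  `γ(v, iv) = 0` for all `v` vanishes (polarisation of the symmetric form `γ(u, iv)`; Lange Lemma 1.2.10: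
  `E` is determined by `H`).
* §2 **`ComplexTorus.eq_zero_of_comp_eq_neg_of_nonneg`**: if `F : E → E` is `ℂ`-linear and `F^*γ = -γ`, a
  `(1,1)`-form `γ` which is `≥ 0` on complex lines vanishes (`0 ≤ γ(Fv, iFv) = -γ(v, iv) ≤ 0`).
* §3 **`ComplexTorus.not_hasPureDim_of_comp_eq_neg`** — ZUCKER'S MECHANISM: if some `ℂ`-linear `F : E → E`
  acts by `-1` on the integral `(1,1)`-classes `H²(X, ℤ) ∩ H^{1,1}` (`γ ∘ F = -γ`), then `X` contains no closed
  analytic subset of codimension one (`rk Λ = 2d + 2`); `…_of_comp_eq_neg_hodgeClasses` (rational classes).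
* §4 Re-derivation for Zucker's explicit torus `T₀ = ℂ²/L₀` from `J^* = -1` on `B¹(T₀)`
  (`Zucker.apply_JL_of_mem_hodgeClasses`, §6 of `ComplexTorusZuckerNoCurves`): `Zucker.not_hasPureDim_one'`.

Theorems only; no definition, no named fact.

## References

* [Zucker1977] S. Zucker, Compositio Math. 34 (1977), Appendix B, Theorem p. 208 and its proof.
* [Lange2023AbelianVarietiesComplex] H. Lange, Abelian Varieties over the Complex Numbers (2023), §1.2.2
  Lemma 1.2.10 (`H(u, v) = E(iu, v) + iE(u, v)`).
* [GriffithsHarrisPrinciples1978] P. Griffiths, J. Harris, Principles of Algebraic Geometry (1978), Ch. 0 §2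
  (Wirtinger), Ch. 3 §1 (Lelong).
-/

noncomputable section

open scoped Manifold ComplexOrder
open Complex Module Set Function
open Literature.Analysis.Complex (IsOfTypeAt)

universe u

namespace Literature.Geometry.Kaehler

namespace ComplexTorus

/-! ### §1 A `(1,1)`-form vanishing on all complex lines vanishes -/

section Polarisation

variable {V : Type*} [NormedAddCommGroup V] [NormedSpace ℂ V]

/-- Antisymmetry of a `ℂ`-valued `2`-form. [folklore] -/
private theorem ctf_swap' (γ : V [⋀^Fin 2]→L[ℝ] ℂ) (x y : V) : γ ![x, y] = -γ ![y, x] := by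
  have h := γ.toAlternatingMap.map_swap ![y, x] (show (0 : Fin 2) ≠ 1 by decide)
  have e : (![y, x] ∘ Equiv.swap (0 : Fin 2) 1) = ![x, y] := by
    funext i; fin_cases i <;> rfl
  rw [e] at h
  exact h

/-- Additivity in the first slot. [folklore] -/
private theorem ctf_add_left' (γ : V [⋀^Fin 2]→L[ℝ] ℂ) (x y w : V) : γ ![x + y, w] = γ ![x, w] + γ ![y, w] :=
  γ.vecCons_add ![w] x y

/-- Additivity in the second slot. [folklore] -/
private theorem ctf_add_right' (γ : V [⋀^Fin 2]→L[ℝ] ℂ) (w x y : V) : γ ![w, x + y] = γ ![w, x] + γ ![w, y] := by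
  rw [ctf_swap' γ w, ctf_add_left', ctf_swap' γ x, ctf_swap' γ y]; ring

/-- `γ(-x, w) = -γ(x, w)`. [folklore] -/
private theorem ctf_neg_left' (γ : V [⋀^Fin 2]→L[ℝ] ℂ) (x w : V) : γ ![-x, w] = -γ ![x, w] := by
  rw [← neg_one_smul ℝ x, show γ ![(-1 : ℝ) • x, w] = (-1 : ℝ) • γ ![x, w] from γ.vecCons_smul ![w] (-1) x]
  simp

/-- **A `2`-form of type `(1,1)` with `γ(v, iv) = 0` for every `v` is zero**: the form `b(u, v) = γ(u, iv)` is
symmetric (type `(1,1)`) and vanishes on the diagonal, hence vanishes (polarisation), and `γ(u, w) = b(u, -iw)`.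
(Lange, Lemma 1.2.10: the alternating form `E` is recovered from the hermitian form `H(u, v) = E(iu, v) + iE(u, v)`.)
[cite: Lange2023AbelianVarietiesComplex, §1.2.2 Lemma 1.2.10] -/
theorem eq_zero_of_typeOneOne_of_forall_apply_I_smul_eq_zero {γ : V [⋀^Fin 2]→L[ℝ] ℂ}
    (h11 : ∀ u v : V, γ ![I • u, I • v] = γ ![u, v]) (h0 : ∀ v : V, γ ![v, I • v] = 0) : γ = 0 := by
  -- `b(u, v) = γ(u, iv)` is symmetric
  have hsymm : ∀ u v : V, γ ![u, I • v] = γ ![v, I • u] := by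
    intro u v
    have h1 := h11 u (I • v)
    rw [smul_smul, I_mul_I, neg_one_smul] at h1
    -- `γ(iu, -v) = γ(u, iv)`, i.e. `-γ(iu, v) = γ(u, iv)`, and `γ(iu, v) = -γ(v, iu)`
    rw [ctf_swap' γ (I • u) (-v), ctf_neg_left', neg_neg] at h1
    exact h1.symm
  -- polarisation
  have hb : ∀ u v : V, γ ![u, I • v] = 0 := by
    intro u v
    have h := h0 (u + v)
    rw [smul_add, ctf_add_left', ctf_add_right', ctf_add_right', h0 u, h0 v, hsymm v u, zero_add, add_zero,
      ← two_mul, mul_eq_zero] at h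
    exact h.resolve_left two_ne_zero
  ext w
  have hw : w = ![w 0, I • (-(I • w 1))] := by
    funext i; fin_cases i
    · rfl
    · simp [smul_smul]
  rw [hw, hb, ContinuousAlternatingMap.coe_zero, Pi.zero_apply]

/-! ### §2 Anti-invariance under a `ℂ`-linear map kills non-negative `(1,1)`-forms -/

/-- **If `F^*γ = -γ` for a `ℂ`-linear `F`, a `(1,1)`-form which is `≥ 0` on all complex lines is `0`**:
`0 ≤ γ(Fv, iFv) = (F^*γ)(v, iv) = -γ(v, iv) ≤ 0`, so `γ(v, iv) = 0` for all `v`, and §1 applies. This is the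
point-wise form of "an effective cycle `Z` with `[Z] + J^*[Z] = 0` cannot exist".
[cite: Zucker1977, Appendix B, proof of the Theorem p. 208] -/
theorem eq_zero_of_comp_eq_neg_of_nonneg {γ : V [⋀^Fin 2]→L[ℝ] ℂ} (F : V →L[ℂ] V)
    (hF : γ.compContinuousLinearMap (F.restrictScalars ℝ) = -γ)
    (h11 : ∀ u v : V, γ ![I • u, I • v] = γ ![u, v]) (hpos : ∀ v : V, 0 ≤ γ ![v, I • v]) : γ = 0 := by
  refine eq_zero_of_typeOneOne_of_forall_apply_I_smul_eq_zero h11 fun v ↦ ?_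
  have h1 : γ ![F v, I • F v] = -γ ![v, I • v] := by
    have h := congrArg (fun δ : V [⋀^Fin 2]→L[ℝ] ℂ ↦ δ ![v, I • v]) hF
    simp only [ContinuousAlternatingMap.compContinuousLinearMap_apply, ContinuousAlternatingMap.neg_apply] at h
    have e : ((F.restrictScalars ℝ : V →L[ℝ] V) ∘ ![v, I • v]) = ![F v, I • F v] := by
      funext i; fin_cases i
      · rfl
      · simp
    rwa [e] at h
  have h2 : 0 ≤ -γ ![v, I • v] := h1 ▸ hpos (F v)
  exact le_antisymm (neg_nonneg.1 h2) (hpos v)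

end Polarisation

/-! ### §3 Zucker's mechanism: anti-invariant divisor classes ⇒ no analytic hypersurface -/

section Torus

variable {ι : Type*} [Fintype ι] [DecidableEq ι] {E : Type u} [NormedAddCommGroup E] [InnerProductSpace ℂ E]
  [FiniteDimensional ℂ E] [MeasurableSpace E] [BorelSpace E] (Φ : (ι → ℝ) ≃L[ℝ] E) {n d : ℕ} (e : Fin n ≃ ι)

omit [FiniteDimensional ℂ E] [MeasurableSpace E] [BorelSpace E] in
/-- The real `2`-frame of a complex `1`-frame is `(v, iv)`. [folklore] -/
private theorem complexFrame_one' (v : Fin 1 → E) : complexFrame v = ![v 0, I • v 0] := by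
  funext i; fin_cases i <;> simp [complexFrame]

omit [FiniteDimensional ℂ E] [MeasurableSpace E] [BorelSpace E] in
/-- Type `(1,1)` gives `γ(iu, iv) = γ(u, v)`. [cite: Lange2023AbelianVarietiesComplex, §1.2.2 Prop. 1.2.9] -/
private theorem apply_I_smul_of_isOfTypeAt_one_one' {γ : E [⋀^Fin 2]→L[ℝ] ℂ} (h : IsOfTypeAt 1 1 γ) (u v : E) :
    γ ![I • u, I • v] = γ ![u, v] :=
  Zucker.apply_I_smul_of_isOfTypeAt_one_one h u v

include e in
/-- **ZUCKER'S MECHANISM (codimension one).** Let `X = E/Φ(ℤ^ι)` be a complex torus (`rk Λ = 2d + 2`) and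
`F : E → E` a `ℂ`-linear map acting by `-1` on the integral `(1,1)`-classes: `γ ∘ F = -γ` for every
`γ ∈ H²(X, ℤ) ∩ H^{1,1}` (e.g. the analytic representation of an automorphism `u` with `u^* = -1` on `NS(X)`).
Then `X` contains NO closed analytic subset of codimension one: the class of a hypersurface would be an integral
`(1,1)`-class, `≥ 0` on complex lines (Lelong) and non-zero, impossible by §2.
[cite: Zucker1977, Appendix B, Theorem p. 208 (proof)] [cite: GriffithsHarrisPrinciples1978, Ch. 0 §2 and Ch. 3 §1] -/
theorem not_hasPureDim_of_comp_eq_neg (h : 2 * d + 2 * 1 = n) (F : E →L[ℂ] E)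
    (hF : ∀ γ ∈ integralHodgeClasses Φ 1, γ.compContinuousLinearMap (F.restrictScalars ℝ) = -γ)
    (Z : Set (ComplexTorus Φ)) : ¬ HasPureDim 𝓘(ℂ, E) Z d := by
  refine not_hasPureDim_of_forall_nonneg_integralHodgeClass_eq_zero Φ e h (fun γ hγ hpos ↦ ?_) Z
  have h11 : ∀ u v : E, γ ![I • u, I • v] = γ ![u, v] :=
    apply_I_smul_of_isOfTypeAt_one_one' ((mem_integralHodgeClasses_iff Φ).1 hγ).2
  refine eq_zero_of_comp_eq_neg_of_nonneg F (hF γ hγ) h11 fun v ↦ ?_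
  have hv := hpos fun _ ↦ v
  rwa [complexFrame_one'] at hv

include e in
/-- The same with anti-invariance assumed on the RATIONAL `(1,1)`-classes `B¹(X) = H²(X, ℚ) ∩ H^{1,1}`.
[cite: Zucker1977, Appendix B, Theorem p. 208 (proof)] -/
theorem not_hasPureDim_of_comp_eq_neg_hodgeClasses (h : 2 * d + 2 * 1 = n) (F : E →L[ℂ] E)
    (hF : ∀ γ ∈ hodgeClasses Φ 1, γ.compContinuousLinearMap (F.restrictScalars ℝ) = -γ)
    (Z : Set (ComplexTorus Φ)) : ¬ HasPureDim 𝓘(ℂ, E) Z d :=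
  not_hasPureDim_of_comp_eq_neg Φ e h F (fun γ hγ ↦ hF γ (integralHodgeClasses_subset_hodgeClasses Φ 1 hγ)) Z

include e in
/-- Codimension form: no closed analytic subset of pure codimension one (`dim E = d + 1`).
[cite: Zucker1977, Appendix B, Theorem p. 208 (proof)] -/
theorem not_hasPureCodim_one_of_comp_eq_neg (h : 2 * d + 2 * 1 = n) (hd : d + 1 = finrank ℂ E) (F : E →L[ℂ] E)
    (hF : ∀ γ ∈ hodgeClasses Φ 1, γ.compContinuousLinearMap (F.restrictScalars ℝ) = -γ)
    (Z : Set (ComplexTorus Φ)) : ¬ HasPureCodim 𝓘(ℂ, E) Z 1 :=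
  fun hZ ↦ not_hasPureDim_of_comp_eq_neg_hodgeClasses Φ e h F hF Z ⟨1, hd, hZ⟩

end Torus

end ComplexTorus

/-! ### §4 Zucker's torus `T₀` again, through the mechanism -/

namespace Zucker

open ComplexTorus

/-- `J^* = -1` on `B¹(T₀)` in pull-back form: `γ ∘ JL = -γ` for every rational `(1,1)`-class of `T₀`
(`apply_JL_of_mem_hodgeClasses`). [cite: Zucker1977, Appendix B Theorem p. 208] -/
theorem compContinuousLinearMap_JL_of_mem_hodgeClasses {γ : EuclideanSpace ℂ (Fin 2) [⋀^Fin (2 * 1)]→L[ℝ] ℂ}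
    (hγ : γ ∈ hodgeClasses skewPeriodL2 1) :
    γ.compContinuousLinearMap (JL.restrictScalars ℝ) = -γ := by
  ext v
  have hv : ((JL.restrictScalars ℝ : _ →L[ℝ] _) ∘ v) = ![JL (v 0), JL (v 1)] := by
    funext i; fin_cases i <;> rfl
  have hv' : v = ![v 0, v 1] := by funext i; fin_cases i <;> rfl
  rw [ContinuousAlternatingMap.compContinuousLinearMap_apply, hv, ContinuousAlternatingMap.neg_apply,
    apply_JL_of_mem_hodgeClasses hγ, ← hv']

/-- **Zucker's Theorem for `T₀` through Zucker's own mechanism**: `J^* = -1` on `B¹(T₀)` (Proposition p. 207,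
cohomology side) and the positivity of classes of analytic curves give at once that `T₀ = ℂ²/L₀` (Euclidean
presentation) contains no analytic curve — a second proof of `Zucker.not_hasPureDim_one_skewPeriodL2`.
[cite: Zucker1977, Appendix B Theorem p. 208] -/
theorem not_hasPureDim_one_skewPeriodL2' (Z : Set (ComplexTorus skewPeriodL2)) :
    ¬ HasPureDim 𝓘(ℂ, EuclideanSpace ℂ (Fin 2)) Z 1 :=
  not_hasPureDim_of_comp_eq_neg_hodgeClasses skewPeriodL2 (n := 4) (Equiv.refl (Fin 4)) (by norm_num) JL
    (fun _ hγ ↦ compContinuousLinearMap_JL_of_mem_hodgeClasses hγ) Z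

end Zucker

end Literature.Geometry.Kaehler

end
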